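import Summits.CriticalPhenomena.PercolationContinuityZ3.Theorems.PercNearOneGluingNoHeavyQuantHullHigh
import Summits.CriticalPhenomena.PercolationContinuityZ3.Theorems.PercNearOneGluingNoHeavyQuantLightSiblingForest
import HarnessLib

/-!
# QUANT lane R8, T-DEC: "NO POSITIVE LOW ATOM" COMPOSES — a gated sibling whose charged positive atoms are all `≥` half its mean is
# hull + high decomposable; hence every forest of such siblings (in particular: every sibling with `q·E[count] ≤ 2`) is SDEC OUTRIGHT

builds on p205010 (kernel theorem, internal audit signed; external expert review pending)

Support file (`--supports stmt-CriticalPhenomena-4575`), QUANT lane seat prim-quant-census-1 (gen 29); memo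
`run/shared/lean/prim/quant/prim-quant-census-1/g29/HULLHIGH-G29.md` §3.  Theorems only, standard axioms, no sorries.  Over census-1 g29's
`…QuantHullHigh` (`IsHigh`, `HullHigh`, `HullHigh.mix`, `hullHigh_of_isHigh`, `hullHigh_of_inBlobHull`, `sdec_flaw_of_hullHigh`) and typer's
`Sib.TreeOK.afford` (`…QuantLightSiblingForest`).

THE OBSERVATION.  Arm-1 g49's low-ceiling criterion says that ONE law with no positive low atom (every charged `h ≥ 1` has `2h ≥ T`) is DEC at
every layer; it says nothing about a FOREST of such siblings, whose law has plenty of positive low atoms.  The hull+high class closes the gap: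
a probability law `ν` on `{0..M}` with mean `m > 0`, top-affordable at `x` (`x·M ≤ m`), all of whose charged POSITIVE atoms satisfy `m ≤ 2h`, is
HULL + HIGH DECOMPOSABLE (`hullHigh_of_noPosLow`): move the atom `0` together with the fraction `θ = m·ν(0)/Σ_{h>m}(h−m)ν(h) ≤ 1` of the mass
above the mean into the law `π ∝ ν(0)δ₀ + θ·ν|_{(m,M]}`, which has mean `m` and is the EXPLICIT single-blob mixture `Σ_h (h·π(h)/m)·blobLaw[(h, m/h)]`
(`inBlobHull_of_support_ge_mean`, the moment identity behind census-1 g28's `inBlobHull_of_mean_le_one` — there `m ≤ 1` made every positive atom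
`≥ m`); the rest `λ ∝ ν − u·π` lives on the charged positive atoms, has mean `m`, and is HIGH.  The torque identity `Σ_{h>m}(h−m)ν(h) =
Σ_{h<m}(m−h)ν(h) ≥ m·ν(0)` is what makes `θ ≤ 1`.  Consequences (all k-free, oracle-free, via `sdec_flaw_of_hullHigh`):
* **`hullHigh_gate_of_noPosLow`** — a law-OK gated sibling `gate s.ρ s.q` with `x·s.M ≤ s.q·s.mean` whose charged sub-forest atoms `h ≥ 1` satisfy
  `s.q·s.mean ≤ 2h` is hull+high decomposable; **`hullHigh_gate_of_meanTwo`** — in particular EVERY sibling with `s.q·s.mean ≤ 2` (twice census-1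
  g28's mean-light threshold; every 2-chain, every sibling with at most two expected reached relays);
* **`sdec_flaw_of_noPosLow(_treeOK)`**, **`sdec_flaw_of_meanTwo(_treeOK)`** — every forest ALL of whose siblings are such is `SDEC x (ftop L) (flaw L)`,
  ANY width, any sub-trees, NO oracle.  (Arm-1 g54's `sdec_flaw_of_fmean_le_two` needs the TOTAL mean `≤ 2`; here each sibling's own.)
CENSUS (kit j280666, memo §4; 21 479 random tree-OK siblings at the true floor, 11 shapes × 5 gate modes, inner LP with gate grid 13): hull+high
decomposable 96.0 % (vs exact hull 81.9 %, vs g28's mean-light ∪ floor criteria 51.4 %); 100 % of 2-chains, cherries, 3-stars, glued-root pairs.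

HONEST STATUS.  Sufficient criterion; `SiblingStep` ⟺ `GateStepN`, `UPartStep`, `LightResidDECOracle`, `FarTreeRow` OPEN; RATE class (log\*) /
honest sentence of `run/shared/lean/prim/quant/README.md` unchanged.  [this work].  Nothing here is cited as a published result.  The gluing rows
served [cite: KozmaNitzan2024, Conjecture 3 (p. 15)]; product measure [cite: Grimmett1999, §1.3 p. 10].
-/

noncomputable section

open scoped BigOperators

namespace Summit.CriticalPhenomena.PercolationContinuityZ3.Theorems
namespace Quant
namespace LawDec

open Finset

/-! ### A law supported on `{0} ∪ [m, K]` is an explicit mixture of single heavy blobs -/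

/-- **A LAW ON `{0..K}` WITH MEAN `m > 0` WHOSE CHARGED POSITIVE ATOMS ARE ALL `≥ m` LIES IN THE BLOB HULL at every floor `x` with `x·K ≤ m`** —
as the mixture `Σ_{h ≥ m} (h·σ(h)/m)·blobLaw [(h, m/h)]` (gates `m/h ∈ [m/K, 1]`; the atom `0` by the moment identity).  Census-1 g28's
`inBlobHull_of_mean_le_one` is the case `m ≤ 1`. [this work] -/
theorem inBlobHull_of_support_ge_mean (x m : ℝ) (K : ℕ) (σ : ℕ → ℝ) (hσ0 : ∀ h, 0 ≤ σ h) (hσK : ∀ h, K < h → σ h = 0)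
    (hσ1 : ∑ h ∈ Finset.range (K + 1), σ h = 1) (hmean : ∑ h ∈ Finset.range (K + 1), (h : ℝ) * σ h = m)
    (hm0 : 0 < m) (hsupp : ∀ h, 0 < σ h → h ≠ 0 → m ≤ (h : ℝ)) (hx : x * (K : ℝ) ≤ m) : InBlobHull x m K σ := by
  classical
  have hmK : m ≤ K := by
    rw [← hmean, ← mul_one (K : ℝ), ← hσ1, Finset.mul_sum]
    exact Finset.sum_le_sum fun h hh => mul_le_mul_of_nonneg_right (by exact_mod_cast Nat.le_of_lt_succ (Finset.mem_range.1 hh)) (hσ0 h)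
  have hKpos : (0 : ℝ) < K := lt_of_lt_of_le hm0 hmK
  -- the mean without the atom `0`, indexed by `Fin K` (blob sizes `j + 1`)
  have hmean' : ∑ j : Fin K, (((j : ℕ) + 1 : ℕ) : ℝ) * σ ((j : ℕ) + 1) = m := by
    rw [Fin.sum_univ_eq_sum_range (fun j => (((j + 1 : ℕ) : ℝ)) * σ (j + 1)) K, ← hmean, Finset.sum_range_succ']
    simp
  have hmass' : ∑ j : Fin K, σ ((j : ℕ) + 1) = 1 - σ 0 := by
    rw [Fin.sum_univ_eq_sum_range (fun j => σ (j + 1)) K]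
    have := Finset.sum_range_succ' σ K
    rw [hσ1] at this
    linarith
  -- weights vanish on the atoms below the mean
  have hw0 : ∀ j : Fin K, ¬ (m ≤ (((j : ℕ) + 1 : ℕ) : ℝ)) → σ ((j : ℕ) + 1) = 0 := by
    intro j hj
    by_contra hne
    exact hj (hsupp _ (lt_of_le_of_ne (hσ0 _) (Ne.symm hne)) (by omega))
  refine ⟨Fin K, inferInstance, fun j => (((j : ℕ) + 1 : ℕ) : ℝ) * σ ((j : ℕ) + 1) / m,
    fun j => if m ≤ (((j : ℕ) + 1 : ℕ) : ℝ) then [((j : ℕ) + 1, m / (((j : ℕ) + 1 : ℕ) : ℝ))] else [(K, m / (K : ℝ))],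
    fun j => div_nonneg (mul_nonneg (Nat.cast_nonneg _) (hσ0 _)) hm0.le, ?_, fun j p hp => ?_, fun j => ?_, fun j => ?_, fun h => ?_⟩
  · -- weights sum to one
    rw [← Finset.sum_div, hmean', div_self hm0.ne']
  · -- gates in `[x, 1]`
    dsimp only at hp
    split_ifs at hp with hj
    · rw [List.mem_singleton] at hp
      subst hp
      have hjpos : (0 : ℝ) < (((j : ℕ) + 1 : ℕ) : ℝ) := by positivity
      have hjK : (((j : ℕ) + 1 : ℕ) : ℝ) ≤ K := by exact_mod_cast j.2
      refine ⟨?_, ?_⟩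
      · show x ≤ m / (((j : ℕ) + 1 : ℕ) : ℝ)
        rw [le_div_iff₀ hjpos]
        rcases le_or_gt x 0 with hx0 | hx0
        · nlinarith
        · nlinarith
      · show m / (((j : ℕ) + 1 : ℕ) : ℝ) ≤ 1
        rwa [div_le_one hjpos]
    · rw [List.mem_singleton] at hp
      subst hp
      refine ⟨?_, ?_⟩
      · show x ≤ m / (K : ℝ)
        rwa [le_div_iff₀ hKpos]
      · show m / (K : ℝ) ≤ 1
        rwa [div_le_one hKpos]
  · -- tops
    dsimp only
    split_ifs
    · show blobTop [((j : ℕ) + 1, m / (((j : ℕ) + 1 : ℕ) : ℝ))] ≤ K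
      simp only [blobTop, zero_add]; exact j.2
    · show blobTop [(K, m / (K : ℝ))] ≤ K
      simp [blobTop]
  · -- means
    dsimp only
    split_ifs
    · show blobMean [((j : ℕ) + 1, m / (((j : ℕ) + 1 : ℕ) : ℝ))] = m
      simp only [blobMean, zero_add]
      have hjpos : (0 : ℝ) < (((j : ℕ) + 1 : ℕ) : ℝ) := by positivity
      field_simp
    · show blobMean [(K, m / (K : ℝ))] = m
      simp only [blobMean, zero_add]
      field_simp
  · -- the mixture identity, atom by atom; the terms below the mean have weight zero
    have term : ∀ j : Fin K, (((j : ℕ) + 1 : ℕ) : ℝ) * σ ((j : ℕ) + 1) / m *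
        blobLaw (if m ≤ (((j : ℕ) + 1 : ℕ) : ℝ) then [((j : ℕ) + 1, m / (((j : ℕ) + 1 : ℕ) : ℝ))] else [(K, m / (K : ℝ))]) h
        = (((j : ℕ) + 1 : ℕ) : ℝ) * σ ((j : ℕ) + 1) / m * blobLaw [((j : ℕ) + 1, m / (((j : ℕ) + 1 : ℕ) : ℝ))] h := by
      intro j
      split_ifs with hj
      · rfl
      · rw [hw0 j hj]; simp
    rw [Finset.sum_congr rfl fun j _ => term j]
    simp only [blobLaw_single_apply]
    by_cases h0 : h = 0
    · subst h0
      have e : ∀ j : Fin K, (((j : ℕ) + 1 : ℕ) : ℝ) * σ ((j : ℕ) + 1) / m *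
          ((if (0 : ℕ) = 0 then 1 - m / (((j : ℕ) + 1 : ℕ) : ℝ) else 0) + (if (0 : ℕ) = (j : ℕ) + 1 then m / (((j : ℕ) + 1 : ℕ) : ℝ) else 0))
          = (((j : ℕ) + 1 : ℕ) : ℝ) * σ ((j : ℕ) + 1) / m - σ ((j : ℕ) + 1) := by
        intro j
        rw [if_pos rfl, if_neg (by omega)]
        have hjpos : (0 : ℝ) < (((j : ℕ) + 1 : ℕ) : ℝ) := by positivity
        field_simp
        ring
      rw [Finset.sum_congr rfl fun j _ => e j, Finset.sum_sub_distrib, ← Finset.sum_div, hmean', div_self hm0.ne', hmass']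
      ring
    · by_cases hK : h ≤ K
      · obtain ⟨i, rfl⟩ : ∃ i, h = i + 1 := ⟨h - 1, by omega⟩
        have hiK : i < K := by omega
        rw [Finset.sum_eq_single ⟨i, hiK⟩]
        · rw [if_neg h0, if_pos (by simp), zero_add]
          have hjpos : (0 : ℝ) < (((i : ℕ) + 1 : ℕ) : ℝ) := by positivity
          show σ (i + 1) = (((i : ℕ) + 1 : ℕ) : ℝ) * σ (i + 1) / m * (m / (((i : ℕ) + 1 : ℕ) : ℝ))
          field_simp
        · intro j _ hj
          have hne : ¬ (i + 1 = (j : ℕ) + 1) := by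
            intro e
            apply hj
            apply Fin.ext
            show (j : ℕ) = i
            omega
          rw [if_neg h0, if_neg hne]; ring
        · intro hni; exact absurd (Finset.mem_univ _) hni
      · rw [hσK h (not_le.1 hK)]
        symm
        refine Finset.sum_eq_zero fun j _ => ?_
        have hne : ¬ (h = (j : ℕ) + 1) := by have := j.2; omega
        rw [if_neg h0, if_neg hne]; ring

/-! ### No positive low atom ⟹ hull + high -/

/-- **A LAW WITH NO POSITIVE LOW ATOM IS HULL + HIGH DECOMPOSABLE.**  `ν` a probability law on `{0..M}` with mean `m > 0`, `x·M ≤ m`, and every charged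
positive atom `h` with `m ≤ 2h`: `HullHigh x m M ν`.  The hull part is `π ∝ ν(0)·δ₀ + θ·ν|_{(m,M]}` with `θ = m·ν(0)/Σ_{h>m}(h−m)ν(h) ≤ 1` (torque),
a single-blob mixture by `inBlobHull_of_support_ge_mean`; the rest is high. [this work] -/
theorem hullHigh_of_noPosLow (x m : ℝ) (M : ℕ) (ν : ℕ → ℝ) (hν0 : ∀ h, 0 ≤ ν h) (hνM : ∀ h, M < h → ν h = 0)
    (hν1 : ∑ h ∈ Finset.range (M + 1), ν h = 1) (hmean : ∑ h ∈ Finset.range (M + 1), (h : ℝ) * ν h = m) (hm0 : 0 < m)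
    (hnpl : ∀ h, 0 < ν h → h ≠ 0 → m ≤ 2 * (h : ℝ)) (hx : x * (M : ℝ) ≤ m) : HullHigh x m M ν := by
  classical
  -- Case 1: no atom at `0` — the law itself is high.
  by_cases hz : ν 0 = 0
  · exact hullHigh_of_isHigh ⟨hν0, hνM, hν1, hmean, fun h hh => hnpl h hh (fun e => by rw [e, hz] at hh; exact lt_irrefl _ hh), hx⟩
  have hz0 : 0 < ν 0 := lt_of_le_of_ne (hν0 0) (Ne.symm hz)
  -- torque above the mean
  set D : ℝ := ∑ h ∈ Finset.range (M + 1), (if m < (h : ℝ) then ((h : ℝ) - m) * ν h else 0) with hD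
  have htorque : ∑ h ∈ Finset.range (M + 1), ((h : ℝ) - m) * ν h = 0 := by
    have e : ∀ h : ℕ, ((h : ℝ) - m) * ν h = (h : ℝ) * ν h - m * ν h := fun h => by ring
    rw [Finset.sum_congr rfl fun h _ => e h, Finset.sum_sub_distrib, hmean, ← Finset.mul_sum, hν1, mul_one, sub_self]
  have hDeq : D = ∑ h ∈ Finset.range (M + 1), (if m < (h : ℝ) then 0 else (m - (h : ℝ)) * ν h) := by
    have key : ∀ h : ℕ, (if m < (h : ℝ) then ((h : ℝ) - m) * ν h else 0)
        = ((h : ℝ) - m) * ν h + (if m < (h : ℝ) then 0 else (m - (h : ℝ)) * ν h) := by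
      intro h; split_ifs <;> ring
    rw [hD, Finset.sum_congr rfl fun h _ => key h, Finset.sum_add_distrib, htorque, zero_add]
  have hDge : m * ν 0 ≤ D := by
    rw [hDeq, ← Finset.add_sum_erase _ _ (Finset.mem_range.2 (Nat.succ_pos M)), Nat.cast_zero, if_neg (not_lt.2 hm0.le), sub_zero]
    have : 0 ≤ ∑ h ∈ (Finset.range (M + 1)).erase 0, (if m < (h : ℝ) then 0 else (m - (h : ℝ)) * ν h) :=
      Finset.sum_nonneg fun h _ => by
        split_ifs with hh
        · exact le_rfl
        · exact mul_nonneg (by linarith [not_lt.1 hh]) (hν0 h)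
    linarith
  have hD0 : 0 < D := lt_of_lt_of_le (mul_pos hm0 hz0) hDge
  set θ : ℝ := m * ν 0 / D with hθ
  have hθ0 : 0 ≤ θ := div_nonneg (mul_nonneg hm0.le hz0.le) hD0.le
  have hθ1 : θ ≤ 1 := by rw [hθ, div_le_one hD0]; exact hDge
  have hθD : θ * D = m * ν 0 := by rw [hθ]; field_simp
  -- the hull part (unnormalised) `U = ν(0)δ₀ + θ·ν|_{(m,M]}` and the rest `V`
  set U : ℕ → ℝ := fun h => if h = 0 then ν 0 else if m < (h : ℝ) then θ * ν h else 0 with hU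
  set V : ℕ → ℝ := fun h => ν h - U h with hV
  have hU0 : ∀ h, 0 ≤ U h := fun h => by
    simp only [hU]; split_ifs
    · exact hz0.le
    · exact mul_nonneg hθ0 (hν0 h)
    · exact le_rfl
  have hUle : ∀ h, U h ≤ ν h := fun h => by
    simp only [hU]; split_ifs with h0
    · rw [h0]
    · nlinarith [hν0 h]
    · exact hν0 h
  have hV0 : ∀ h, 0 ≤ V h := fun h => by simp only [hV]; linarith [hUle h]
  have hUM : ∀ h, M < h → U h = 0 := fun h hh => by
    have := hUle h; rw [hνM h hh] at this; exact le_antisymm this (hU0 h)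
  have hVM : ∀ h, M < h → V h = 0 := fun h hh => by simp only [hV]; rw [hνM h hh, hUM h hh, sub_zero]
  set u : ℝ := ∑ h ∈ Finset.range (M + 1), U h with hu
  -- first moment of `U` is `m·u`
  have hUmean : ∑ h ∈ Finset.range (M + 1), (h : ℝ) * U h = m * u := by
    -- `Σ h·U h = θ·Σ_{h>m} h ν h = θ·(D + m·Σ_{h>m} ν h)` and `u = ν 0 + θ·Σ_{h>m} ν h`
    have e1 : ∀ h : ℕ, (h : ℝ) * U h = θ * (if m < (h : ℝ) then ((h : ℝ) - m) * ν h else 0) + m * (U h - (if h = 0 then ν 0 else 0)) := by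
      intro h
      simp only [hU]
      split_ifs with h0 h1
      · exfalso; rw [h0, Nat.cast_zero] at h1; exact lt_irrefl _ (h1.trans hm0)
      · rw [h0, Nat.cast_zero]; ring
      · ring
      · ring
    rw [Finset.sum_congr rfl fun h _ => e1 h, Finset.sum_add_distrib, ← Finset.mul_sum, ← hD, hθD, ← Finset.mul_sum,
      Finset.sum_sub_distrib, Finset.sum_ite_eq' (Finset.range (M + 1)) 0 (fun _ => ν 0), if_pos (Finset.mem_range.2 (Nat.succ_pos M))]
    ring
  have hu0 : 0 < u := by
    rw [hu, ← Finset.add_sum_erase _ _ (Finset.mem_range.2 (Nat.succ_pos M))]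
    have : 0 ≤ ∑ h ∈ (Finset.range (M + 1)).erase 0, U h := Finset.sum_nonneg fun h _ => hU0 h
    have e : U 0 = ν 0 := by simp [hU]
    linarith
  have hu1 : u ≤ 1 := by rw [hu, ← hν1]; exact Finset.sum_le_sum fun h _ => hUle h
  -- the hull part
  have hπ : InBlobHull x m M (fun h => U h / u) := by
    refine inBlobHull_of_support_ge_mean x m M _ (fun h => div_nonneg (hU0 h) hu0.le) (fun h hh => by rw [hUM h hh, zero_div])
      (by rw [← Finset.sum_div, div_self hu0.ne']) ?_ hm0 (fun h hh h0 => ?_) hx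
    · have e : ∀ h : ℕ, (h : ℝ) * (U h / u) = ((h : ℝ) * U h) / u := fun h => by ring
      rw [Finset.sum_congr rfl fun h _ => e h, ← Finset.sum_div, hUmean, mul_div_assoc, div_self hu0.ne', mul_one]
    · have hUh : 0 < U h := by
        have := div_pos_iff.1 hh
        rcases this with ⟨h1, _⟩ | ⟨_, h2⟩
        · exact h1
        · exact absurd h2 (not_lt.2 hu0.le)
      simp only [hU, if_neg h0] at hUh
      split_ifs at hUh with h1
      · exact h1.le
      · exact absurd hUh (lt_irrefl 0)
  -- Case 2: the rest is empty — `ν` is the hull part.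
  by_cases hs : u = 1
  · have hVz : ∀ h, V h = 0 := by
      have hsum : ∑ h ∈ Finset.range (M + 1), V h = 0 := by
        rw [hV]; simp only []; rw [Finset.sum_sub_distrib, hν1, ← hu, hs, sub_self]
      intro h
      by_cases hh : h ∈ Finset.range (M + 1)
      · exact (Finset.sum_eq_zero_iff_of_nonneg fun k _ => hV0 k).1 hsum h hh
      · exact hVM h (by rw [Finset.mem_range] at hh; omega)
    have e : ν = fun h => U h / u := funext fun h => by
      have := hVz h; simp only [hV] at this; rw [hs, div_one]; linarith
    rw [e]; exact hullHigh_of_inBlobHull hπ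
  -- Case 3: the rest `λ = V/(1−u)` is a high law and `ν = u·π + (1−u)·λ`.
  have hs0 : 0 < 1 - u := by have := lt_of_le_of_ne hu1 hs; linarith
  have hVsum : ∑ h ∈ Finset.range (M + 1), V h = 1 - u := by
    rw [hV]; simp only []; rw [Finset.sum_sub_distrib, hν1, ← hu]
  have hVmean : ∑ h ∈ Finset.range (M + 1), (h : ℝ) * V h = m * (1 - u) := by
    have e : ∀ h : ℕ, (h : ℝ) * V h = (h : ℝ) * ν h - (h : ℝ) * U h := fun h => by simp only [hV]; ring
    rw [Finset.sum_congr rfl fun h _ => e h, Finset.sum_sub_distrib, hmean, hUmean]; ring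
  have hlam : IsHigh x m M (fun h => V h / (1 - u)) := by
    refine ⟨fun h => div_nonneg (hV0 h) hs0.le, fun h hh => show V h / (1 - u) = 0 by rw [hVM h hh, zero_div],
      by rw [← Finset.sum_div, hVsum, div_self hs0.ne'], ?_, fun h hh => ?_, hx⟩
    · have e : ∀ h : ℕ, (h : ℝ) * (V h / (1 - u)) = ((h : ℝ) * V h) / (1 - u) := fun h => by ring
      rw [Finset.sum_congr rfl fun h _ => e h, ← Finset.sum_div, hVmean, mul_div_assoc, div_self hs0.ne', mul_one]
    · have hVh : 0 < V h := by
        rcases div_pos_iff.1 hh with ⟨h1, _⟩ | ⟨_, h2⟩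
        · exact h1
        · exact absurd h2 (not_lt.2 hs0.le)
      have h0 : h ≠ 0 := by
        rintro rfl
        have hV00 : V 0 = 0 := by simp [hV, hU]
        rw [hV00] at hVh; exact lt_irrefl _ hVh
      exact hnpl h (lt_of_lt_of_le hVh (by linarith [hUle h, hU0 h])) h0
  have e : ν = fun h => u * (U h / u) + (1 - u) * (V h / (1 - u)) := funext fun h => by
    simp only [hV]; field_simp; ring
  rw [e]
  exact (hullHigh_of_inBlobHull hπ).mix (hullHigh_of_isHigh hlam) hu0.le hu1

/-! ### Siblings and forests -/

/-- **A GATED SIBLING WITH NO POSITIVE LOW ATOM IS HULL + HIGH DECOMPOSABLE**: law-OK `s`, `0 < s.mean`, floor `x·s.M ≤ s.q·s.mean`, and every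
charged atom `h ≥ 1` of the sub-forest law with `s.q·s.mean ≤ 2h` ⟹ `HullHigh x (s.q·s.mean) s.M (gate s.ρ s.q)`. [this work] -/
theorem hullHigh_gate_of_noPosLow {x : ℝ} (s : Sib) (hs : s.LawOK) (hmean0 : 0 < s.mean) (hfl : x * (s.M : ℝ) ≤ s.q * s.mean)
    (hnpl : ∀ h, 0 < s.ρ h → h ≠ 0 → s.q * s.mean ≤ 2 * (h : ℝ)) : HullHigh x (s.q * s.mean) s.M (gate s.ρ s.q) := by
  obtain ⟨hq0, hq1, ρ0, ρM, ρ1⟩ := hs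
  obtain ⟨g0, gM, g1⟩ := gate_laws s.M s.ρ s.q hq0.le hq1.le ρ0 ρM ρ1
  have gmean : ∑ h ∈ Finset.range (s.M + 1), (h : ℝ) * gate s.ρ s.q h = s.q * s.mean := by rw [sum_mul_gate]; rfl
  refine hullHigh_of_noPosLow x (s.q * s.mean) s.M (gate s.ρ s.q) g0 gM g1 gmean (mul_pos hq0 hmean0) (fun h hh h0 => ?_) hfl
  have hgh : gate s.ρ s.q h = s.q * s.ρ h := by rw [gate_apply, if_neg h0, mul_zero, add_zero]
  rw [hgh] at hh
  exact hnpl h (lt_of_le_of_ne (ρ0 h) (fun e => by rw [← e, mul_zero] at hh; exact lt_irrefl _ hh)) h0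

/-- **… IN PARTICULAR EVERY SIBLING WITH `q·E[count] ≤ 2`** (every charged atom `h ≥ 1` has `2h ≥ 2 ≥ q·mean`). [this work] -/
theorem hullHigh_gate_of_meanTwo {x : ℝ} (s : Sib) (hs : s.LawOK) (hmean0 : 0 < s.mean) (hfl : x * (s.M : ℝ) ≤ s.q * s.mean)
    (htwo : s.q * s.mean ≤ 2) : HullHigh x (s.q * s.mean) s.M (gate s.ρ s.q) :=
  hullHigh_gate_of_noPosLow s hs hmean0 hfl fun h _ h0 => by
    have : (1 : ℝ) ≤ h := by exact_mod_cast Nat.one_le_iff_ne_zero.2 h0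
    linarith

/-- **EVERY FOREST OF NO-POSITIVE-LOW SIBLINGS IS SDEC — any width, any sub-trees, NO oracle.**  Law-OK siblings with positive sub-forest means,
floors `x·sᵢ.M ≤ sᵢ.q·sᵢ.mean`, and for every member every charged atom `h ≥ 1` with `sᵢ.q·sᵢ.mean ≤ 2h`; `0 < x < 1`. [this work] -/
theorem sdec_flaw_of_noPosLow {x : ℝ} (hx0 : 0 < x) (hx1 : x < 1) (L : List Sib) (hL : ∀ s ∈ L, s.LawOK)
    (hmean0 : ∀ s ∈ L, 0 < s.mean) (hfl : ∀ s ∈ L, x * (s.M : ℝ) ≤ s.q * s.mean)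
    (hnpl : ∀ s ∈ L, ∀ h, 0 < s.ρ h → h ≠ 0 → s.q * s.mean ≤ 2 * (h : ℝ)) : SDEC x (ftop L) (flaw L) :=
  sdec_flaw_of_hullHigh hx0 hx1 L fun s hs => hullHigh_gate_of_noPosLow s (hL s hs) (hmean0 s hs) (hfl s hs) (hnpl s hs)

/-- **THE TREE-OK FORM**: a nonempty tree-OK list each of whose members has no positive low atom (`sᵢ.q·sᵢ.mean ≤ 2h` for every charged `h ≥ 1`) is
SDEC at its floor, no oracle. [this work] -/
theorem sdec_flaw_of_noPosLow_treeOK {x : ℝ} (hx0 : 0 < x) (L : List Sib) (hL : ∀ s ∈ L, s.TreeOK x) (hne : L ≠ [])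
    (hnpl : ∀ s ∈ L, ∀ h, 0 < s.ρ h → h ≠ 0 → s.q * s.mean ≤ 2 * (h : ℝ)) : SDEC x (ftop L) (flaw L) := by
  obtain ⟨s, hs⟩ := List.exists_mem_of_ne_nil L hne
  obtain ⟨_, hq1, hxq, hT, _⟩ := hL s hs
  obtain ⟨_, hx₁1, _, _, _, _⟩ := hT.lawFacts
  have hx1 : x < 1 := by nlinarith
  exact sdec_flaw_of_noPosLow hx0 hx1 L (fun t ht => (hL t ht).lawOK) (fun t ht => Sib.mean_pos t (hL t ht))
    (fun t ht => (hL t ht).afford) hnpl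

/-- **EVERY FOREST OF SIBLINGS WITH `qᵢ·E[countᵢ] ≤ 2` IS SDEC — any width, any sub-trees, NO oracle** (law-OK form with floors). [this work] -/
theorem sdec_flaw_of_meanTwo {x : ℝ} (hx0 : 0 < x) (hx1 : x < 1) (L : List Sib) (hL : ∀ s ∈ L, s.LawOK)
    (hmean0 : ∀ s ∈ L, 0 < s.mean) (hfl : ∀ s ∈ L, x * (s.M : ℝ) ≤ s.q * s.mean) (htwo : ∀ s ∈ L, s.q * s.mean ≤ 2) :
    SDEC x (ftop L) (flaw L) :=
  sdec_flaw_of_hullHigh hx0 hx1 L fun s hs => hullHigh_gate_of_meanTwo s (hL s hs) (hmean0 s hs) (hfl s hs) (htwo s hs)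

/-- **THE TREE-OK FORM**: a nonempty tree-OK list all of whose members have `sᵢ.q·sᵢ.mean ≤ 2` is SDEC at its floor — twice the mean-light
threshold of census-1 g28's `sdec_flaw_of_meanLight_treeOK`, every width, no oracle. [this work] -/
theorem sdec_flaw_of_meanTwo_treeOK {x : ℝ} (hx0 : 0 < x) (L : List Sib) (hL : ∀ s ∈ L, s.TreeOK x) (hne : L ≠ [])
    (htwo : ∀ s ∈ L, s.q * s.mean ≤ 2) : SDEC x (ftop L) (flaw L) :=
  sdec_flaw_of_noPosLow_treeOK hx0 L hL hne fun s hs h _ h0 => by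
    have : (1 : ℝ) ≤ h := by exact_mod_cast Nat.one_le_iff_ne_zero.2 h0
    linarith [htwo s hs]

end LawDec
end Quant
end Summit.CriticalPhenomena.PercolationContinuityZ3.Theorems
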